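import Literature.Geometry.DiscreteGeometry.KissingCertComp
import Literature.Geometry.DiscreteGeometry.KissingCertDataA
import Literature.Geometry.DiscreteGeometry.KissingCertDataB
import Literature.Geometry.DiscreteGeometry.KissingCertDataC

/-!
# Certificate for `k(4) < 25`: validation of the Gram expansion of block `r` (chunk 1)

Row-chunked kernel validation (`chunkOK`, `decide`) that the claimed expansion (`certRrf*`) of the largest
Gram block `r` (120 basis monomials `certRZ`, factor `certRL`) equals `zᵀ(LLᵀ)z`: rows `< c1` sum to
`certRD1f*` (chunk 2 is `KissingCertExpandR2`, the last chunk is in `KissingCertExpandS`).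

The statements are written directly in terms of the raw data of `KissingCertData{A,B,C}`
(decoded by `ofFlat`) and the checker of `KissingCertComp`; they are combined in
`KissingNumberFourProofs`.
-/

namespace Literature.Geometry.DiscreteGeometry

open PolyCert PolyCert.SPoly KissingFourCert

set_option maxHeartbeats 0 in
/-- Block `r`, rows `0 … c1-1`. [folklore] -/
theorem certP_r1 :
    chunkOK (GramBlk.mk certRZ certRL) 0 certRc1 []
      (ofFlat certRD1f0 ++ ofFlat certRD1f1 ++ ofFlat certRD1f2 ++ ofFlat certRD1f3 ++ ofFlat certRD1f4 ++ ofFlat certRD1f5) = true := by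
  decide +kernel

end Literature.Geometry.DiscreteGeometry
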